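import Mathlib
import HarnessLib
import Summits.ValiantsHypothesis.ValiantsHypothesis.Theses.MonotoneRestoration
import Summits.ValiantsHypothesis.ValiantsHypothesis.Theorems.MonotoneRestorationOrbitRestorationLinearVolumeQPBlockDescentRestricted
import Summits.ValiantsHypothesis.ValiantsHypothesis.Theorems.MonotoneRestorationOrbitRestorationLinearVolumeQPNarrow

/-!
# Route MonotoneRestoration — aside `OrbitRestorationLinearVolumeQP` (stmt-ValiantsHypothesis-18294):
# BLOCK DESCENT, part 3 — the one-sorted → two-sorted passage ONE LEVEL DOWN, and LIFTING as the exact residue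
# between the registered stub `LvNarrowSpan` and the crux

Parts 1–2 (`…BlockDescent.lean`, `…BlockDescentRestricted.lean`): the off-diagonal block substitution maps the
one-sorted narrow span at level `n + n` into the bipartite narrow span at level `n` (same width, every degree), and
under R1 every RESTRICTED `VP ∩ LV` family `f↓_n = φ_n(f_{n+n})` satisfies the registered stub's conclusion.  This
file records the two closing statements:

* `principal_mem_narrowSpan_of_mem_diNarrowSpan` — **the ONE-SORTED → TWO-SORTED PASSAGE IN THE TREEWIDTH REGIME,
  ONE LEVEL DOWN:** a matrix-symmetric polynomial at level `n + n` with a one-sorted expansion of width `w` has its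
  PRINCIPAL `n × n` BLOCK restriction (`Y ↦ X ⊕ 0`) in the bipartite narrow span of the SAME width `w` (the passage
  recorded OPEN in `…OrbitCompressionQPTwoSortedPassageSparse.lean` / DPS25 p. 45, settled for the half-size principal
  block with no loss; useful for stmt-18332 / stmt-16191 as well);
* `lvNarrowSpan_of_orbitRestorationLinearVolumeQP_of_lift`, `lvNarrowSpan_iff_orbitRestorationLinearVolumeQP_of_lift`
  — **LIFT ⟹ (`LvNarrowSpan ⟺ R1`)**, where LIFT says: every `VP ∩ LV` family `g` is the restriction `f↓` of some
  `VP ∩ LV` family `f` (`g_n` is `f_{n+n}` read on the principal block; e.g. the level-`n` expansion data of `g_n`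
  re-evaluated at level `n + n` stays in `VP`).  So the registered line `birth` is tight EXACTLY UP TO LIFTING; any
  separation between the stub and the crux must come from a non-liftable `VP ∩ LV` family.

Honest label: bookkeeping on top of parts 1–2; LIFT is NOT proved (it is the named VH-free residue); the stub
`stub_lvNarrowSpan` (Dwivedi–Pago–Seppelt Outlook Q3 at qp scale), R1 and VP ≠ VNP are NOT moved.  Def-free helper
(`--supports stmt-ValiantsHypothesis-18294`); nothing here is a named fact.

References: Dwivedi–Pago–Seppelt 2026 (arXiv:2601.09343) eq. (1), Outlook Q3; Dawar–Pago–Seppelt 2025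
(arXiv:2502.06740) Thm 1.1, Remark p. 17, §7 p. 45.
-/

noncomputable section

open scoped Classical

-- `Summit.ValiantsHypothesis.ValiantsHypothesis.…` is the tree's single-conjunct layout (Sub = Summit).
set_option linter.dupNamespace false

namespace Summit.ValiantsHypothesis.ValiantsHypothesis.Theorems.BlockDescentLift

open Literature.Computability.AlgebraicComplexity MvPolynomial
open Literature.Combinatorics.SimpleGraph (treewidth)
open Summit.ValiantsHypothesis.ValiantsHypothesis.Theorems
open Summit.ValiantsHypothesis.ValiantsHypothesis.Theorems.BlockDescent
open Summit.ValiantsHypothesis.ValiantsHypothesis.Theorems.BlockDescentRestricted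

/-! ### The single-polynomial passage, and LIFTING as the named residue -/

/-- **ONE-SORTED → TWO-SORTED PASSAGE IN THE TREEWIDTH REGIME, ONE LEVEL DOWN.**  A MATRIX-symmetric polynomial
`p` at level `n + n` lying in the span of the one-sorted homomorphism polynomials of patterns of treewidth `≤ w`
(any order, any degree) has its PRINCIPAL-BLOCK restriction `ψ(p)` (`Y ↦ X ⊕ 0`, `X` the `n × n` matrix) in the
span of the BIPARTITE homomorphism polynomials of treewidth `≤ w` — the "directed width `≤ k` ⇒ bipartite width
`≤ k'`" passage recorded OPEN in `…OrbitCompressionQPTwoSortedPassageSparse.lean`, settled with `k' = k` for the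
principal half-size block (block descent `BlockDescent.block_descent_span` + `aeval_block_eq_aeval_principal`).
[folklore] -/
theorem principal_mem_narrowSpan_of_mem_diNarrowSpan {n : ℕ}
    (ψ : Fin (n + n) × Fin (n + n) → MvPolynomial (Fin n × Fin n) ℂ)
    (hψ : ∀ i j : Fin n, ψ (finSumFinEquiv (Sum.inl i), finSumFinEquiv (Sum.inl j)) = X (i, j) ∧
      ψ (finSumFinEquiv (Sum.inl i), finSumFinEquiv (Sum.inr j)) = 0 ∧
      ψ (finSumFinEquiv (Sum.inr i), finSumFinEquiv (Sum.inl j)) = 0 ∧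
      ψ (finSumFinEquiv (Sum.inr i), finSumFinEquiv (Sum.inr j)) = 0)
    (w : ℕ) (p : MvPolynomial (Fin (n + n) × Fin (n + n)) ℂ)
    (hsymm : ∀ σ τ : Equiv.Perm (Fin (n + n)),
      rename (fun ij : Fin (n + n) × Fin (n + n) => (σ ij.1, τ ij.2)) p = p)
    (hp : p ∈ Submodule.span ℂ {q : MvPolynomial (Fin (n + n) × Fin (n + n)) ℂ |
      ∃ (a : ℕ) (D : Multiset (Fin a × Fin a)),
        treewidth (SimpleGraph.fromRel fun u v : Fin a => ∃ e ∈ D, u = e.1 ∧ v = e.2) ≤ w ∧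
          q = diHomPoly D (n + n) ℂ}) :
    aeval ψ p ∈ Submodule.span ℂ {q : MvPolynomial (Fin n × Fin n) ℂ |
      ∃ (a b : ℕ) (F : Multiset (Fin a × Fin b)),
        treewidth (SimpleGraph.fromRel fun u v : Fin a ⊕ Fin b =>
            ∃ e ∈ F, u = Sum.inl e.1 ∧ v = Sum.inr e.2) ≤ w ∧
          q = homPoly F n ℂ} := by
  obtain ⟨φ, hφ⟩ := exists_block n
  rw [← aeval_block_eq_aeval_principal φ ψ hφ hψ p hsymm]
  exact block_descent_span φ hφ w p hp

/-- **LIFTING IS THE RESIDUE: R1 ∧ LIFT ⟹ the registered stub's hypothesis `LvNarrowSpan`.**  Call a family `g`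
LIFTABLE (for the block substitutions `φ_n`) if `g = f↓` for some `VP ∩ LV` family `f` (`g_n = φ_n(f_{n+n})`, i.e.
`g_n` is `f_{n+n}` read on the principal block).  If R1 holds and EVERY `VP ∩ LV` family is liftable, then every
`VP ∩ LV` family lies level by level in the bipartite narrow span of width `(log₂ n + c)^c` — verbatim the hypothesis
of `OrbitRestorationLinearVolumeQPNarrow.orbitRestorationLinearVolumeQP_of_lvNarrowSpan`, i.e. the registered stub.
So `LIFT ⟹ (LvNarrowSpan ⟺ R1)`: the line `birth` is tight exactly up to lifting. [folklore] -/
theorem lvNarrowSpan_of_orbitRestorationLinearVolumeQP_of_lift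
    (hR1 : Summit.ValiantsHypothesis.ValiantsHypothesis.Theses.MonotoneRestoration.OrbitRestorationLinearVolumeQP)
    (φ : (n : ℕ) → Fin (n + n) × Fin (n + n) → MvPolynomial (Fin n × Fin n) ℂ)
    (hφ : ∀ n (i j : Fin n), φ n (finSumFinEquiv (Sum.inl i), finSumFinEquiv (Sum.inr j)) = X (i, j) ∧
      φ n (finSumFinEquiv (Sum.inl i), finSumFinEquiv (Sum.inl j)) = 0 ∧
      φ n (finSumFinEquiv (Sum.inr i), finSumFinEquiv (Sum.inl j)) = 0 ∧
      φ n (finSumFinEquiv (Sum.inr i), finSumFinEquiv (Sum.inr j)) = 0)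
    (hlift : ∀ g : (n : ℕ) → MvPolynomial (Fin n × Fin n) ℂ, IsVPFamily g →
      (∃ (c : ℕ) (m : ℕ → ℕ) (a b : (n : ℕ) → Fin (m n) → ℕ)
          (E : (n : ℕ) → (i : Fin (m n)) → Multiset (Fin (a n i) × Fin (b n i)))
          (α : (n : ℕ) → Fin (m n) → ℂ),
        (∀ n, m n ≤ (n + 2) ^ c) ∧ (∀ n i, a n i + b n i ≤ c * (n + 1)) ∧
          ∀ n, g n = ∑ i : Fin (m n), C (α n i) * homPoly (E n i) n ℂ) →
      ∃ f : (n : ℕ) → MvPolynomial (Fin n × Fin n) ℂ, IsVPFamily f ∧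
        (∃ (c : ℕ) (m : ℕ → ℕ) (a b : (n : ℕ) → Fin (m n) → ℕ)
          (E : (n : ℕ) → (i : Fin (m n)) → Multiset (Fin (a n i) × Fin (b n i)))
          (α : (n : ℕ) → Fin (m n) → ℂ),
        (∀ n, m n ≤ (n + 2) ^ c) ∧ (∀ n i, a n i + b n i ≤ c * (n + 1)) ∧
          ∀ n, f n = ∑ i : Fin (m n), C (α n i) * homPoly (E n i) n ℂ) ∧
        ∀ n, g n = aeval (φ n) (f (n + n))) :
    ∀ g : (n : ℕ) → MvPolynomial (Fin n × Fin n) ℂ, IsVPFamily g →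
      (∃ (c : ℕ) (m : ℕ → ℕ) (a b : (n : ℕ) → Fin (m n) → ℕ)
          (E : (n : ℕ) → (i : Fin (m n)) → Multiset (Fin (a n i) × Fin (b n i)))
          (α : (n : ℕ) → Fin (m n) → ℂ),
        (∀ n, m n ≤ (n + 2) ^ c) ∧ (∀ n i, a n i + b n i ≤ c * (n + 1)) ∧
          ∀ n, g n = ∑ i : Fin (m n), C (α n i) * homPoly (E n i) n ℂ) →
      ∃ c : ℕ, ∀ n : ℕ, g n ∈ Submodule.span ℂ
        {p : MvPolynomial (Fin n × Fin n) ℂ | ∃ (a b : ℕ) (E : Multiset (Fin a × Fin b)),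
          treewidth (SimpleGraph.fromRel fun u v : Fin a ⊕ Fin b =>
                ∃ e ∈ E, u = Sum.inl e.1 ∧ v = Sum.inr e.2) ≤ (Nat.log 2 n + c) ^ c ∧
            p = homPoly E n ℂ} := by
  intro g hg hgLV
  obtain ⟨f, hf, hfLV, hgf⟩ := hlift g hg hgLV
  obtain ⟨c, hc⟩ := restrict_mem_narrowSpan_of_orbitRestorationLinearVolumeQP hR1 φ hφ f hf hfLV
  exact ⟨c, fun n => (hgf n) ▸ hc n⟩

/-- **Hence, granted LIFT, the registered line is TIGHT: `LvNarrowSpan ⟺ R1`** (`⟸` by the previous theorem,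
`⟹` is the tree's `OrbitRestorationLinearVolumeQPNarrow.orbitRestorationLinearVolumeQP_of_lvNarrowSpan`, K2 + K3).
Honest label: LIFT (every `VP ∩ LV` family is the principal-block restriction of a `VP ∩ LV` family one level up) is
NOT proved here; it is the exact VH-free residue of the descent question left by block descent. [folklore] -/
theorem lvNarrowSpan_iff_orbitRestorationLinearVolumeQP_of_lift
    (φ : (n : ℕ) → Fin (n + n) × Fin (n + n) → MvPolynomial (Fin n × Fin n) ℂ)
    (hφ : ∀ n (i j : Fin n), φ n (finSumFinEquiv (Sum.inl i), finSumFinEquiv (Sum.inr j)) = X (i, j) ∧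
      φ n (finSumFinEquiv (Sum.inl i), finSumFinEquiv (Sum.inl j)) = 0 ∧
      φ n (finSumFinEquiv (Sum.inr i), finSumFinEquiv (Sum.inl j)) = 0 ∧
      φ n (finSumFinEquiv (Sum.inr i), finSumFinEquiv (Sum.inr j)) = 0)
    (hlift : ∀ g : (n : ℕ) → MvPolynomial (Fin n × Fin n) ℂ, IsVPFamily g →
      (∃ (c : ℕ) (m : ℕ → ℕ) (a b : (n : ℕ) → Fin (m n) → ℕ)
          (E : (n : ℕ) → (i : Fin (m n)) → Multiset (Fin (a n i) × Fin (b n i)))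
          (α : (n : ℕ) → Fin (m n) → ℂ),
        (∀ n, m n ≤ (n + 2) ^ c) ∧ (∀ n i, a n i + b n i ≤ c * (n + 1)) ∧
          ∀ n, g n = ∑ i : Fin (m n), C (α n i) * homPoly (E n i) n ℂ) →
      ∃ f : (n : ℕ) → MvPolynomial (Fin n × Fin n) ℂ, IsVPFamily f ∧
        (∃ (c : ℕ) (m : ℕ → ℕ) (a b : (n : ℕ) → Fin (m n) → ℕ)
          (E : (n : ℕ) → (i : Fin (m n)) → Multiset (Fin (a n i) × Fin (b n i)))
          (α : (n : ℕ) → Fin (m n) → ℂ),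
        (∀ n, m n ≤ (n + 2) ^ c) ∧ (∀ n i, a n i + b n i ≤ c * (n + 1)) ∧
          ∀ n, f n = ∑ i : Fin (m n), C (α n i) * homPoly (E n i) n ℂ) ∧
        ∀ n, g n = aeval (φ n) (f (n + n))) :
    (∀ g : (n : ℕ) → MvPolynomial (Fin n × Fin n) ℂ, IsVPFamily g →
      (∃ (c : ℕ) (m : ℕ → ℕ) (a b : (n : ℕ) → Fin (m n) → ℕ)
          (E : (n : ℕ) → (i : Fin (m n)) → Multiset (Fin (a n i) × Fin (b n i)))
          (α : (n : ℕ) → Fin (m n) → ℂ),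
        (∀ n, m n ≤ (n + 2) ^ c) ∧ (∀ n i, a n i + b n i ≤ c * (n + 1)) ∧
          ∀ n, g n = ∑ i : Fin (m n), C (α n i) * homPoly (E n i) n ℂ) →
      ∃ c : ℕ, ∀ n : ℕ, g n ∈ Submodule.span ℂ
        {p : MvPolynomial (Fin n × Fin n) ℂ | ∃ (a b : ℕ) (E : Multiset (Fin a × Fin b)),
          treewidth (SimpleGraph.fromRel fun u v : Fin a ⊕ Fin b =>
                ∃ e ∈ E, u = Sum.inl e.1 ∧ v = Sum.inr e.2) ≤ (Nat.log 2 n + c) ^ c ∧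
            p = homPoly E n ℂ}) ↔
    Summit.ValiantsHypothesis.ValiantsHypothesis.Theses.MonotoneRestoration.OrbitRestorationLinearVolumeQP :=
  ⟨OrbitRestorationLinearVolumeQPNarrow.orbitRestorationLinearVolumeQP_of_lvNarrowSpan,
    fun hR1 => lvNarrowSpan_of_orbitRestorationLinearVolumeQP_of_lift hR1 φ hφ hlift⟩

end Summit.ValiantsHypothesis.ValiantsHypothesis.Theorems.BlockDescentLift

end
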